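import Summits.CriticalPhenomena.PercolationContinuityZ3.Theorems.PercNearOneGluingNoHeavyLowerTailThreePointGamma
import HarnessLib

/-!
# `NoHeavyLowerTail` (stmt-CriticalPhenomena-4575) — the EDGE POLAR FORM of `Γ` is nonnegative on every edge, I:
# preliminaries (the certificate as a function of its four read outputs, its monotonicity in `o₃`, the functional `Γ(D,p)`
# and its three-copy representation, the eight-piece split of a three-copy sum along one coordinate)

Support file (prover prim-ineq-gen-2 gen 5; `--supports stmt-CriticalPhenomena-4575`).  Small technical definitions (`Qe`, `gq`, `GamP`, `bits3`,
`bern8`), no named facts, no sorries.  Part II (`…ThreePointGammaEdgePolar`) proves the two pointwise lemmas and the theorem.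

`Γ(D,p) = q t − u_a u_b − u_a u_c − u_b u_c − u_a (n_a + n′_a) ≥ 0` on every finite weighted graph is `ThreePointGamma.gamma_PrW`
(prim-lit-2 PROOF-GAMMA, formalised by prim-cert-2).  Along one coordinate `e ∈ D` (support KEPT, `p⁰ = p[e ↦ 0]`, `p¹ = p[e ↦ 1]`)
`p_e ↦ Γ(D,p)` is quadratic: `Γ(D,p) = (1−p_e)² Γ(D,p⁰) + p_e(1−p_e)·S01_e + p_e² Γ(D,p¹)`, where `S01_e = 2 B_e` is the polar form of the
quadratic form `Γ` between the two section laws of `e` (ttrl2 census `hms`, lines 398/469: `S01 ≥ 0` on all 606.8 M exact edge-steps of all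
weighted graphs with `≤ 8` vertices and on 8 439 adversarial climbs with `≤ 12` vertices — for EVERY edge type).

**Theorem** (`gamP_edge_polar`, this file): `(1 − p_e)²·Γ(D,p⁰) + p_e²·Γ(D,p¹) ≤ Γ(D,p)` for every `e ∈ D`, i.e. `S01_e ≥ 0`;
hence `Γ ≥ 0` is inductive along ANY edge order and `Γ(D,p) ≥ Σ_ξ w(ξ)² Γ(D,p^ξ)` over the states `ξ` of any edge set.

Proof (prim-ineq-gen-2 S01-THEOREM.md).  PROOF-GAMMA writes `Γ = Σ_x wt3W(x)·F(x)` over triples `x = (X,Y,Z)`, `F = −gcert ∈ {0,1}`.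
Splitting along `e` (`DTree3.sum_triples_split`), `Γ(D,p) − (1−p_e)²Γ⁰⁰ − p_e²Γ¹¹ = p_e(1−p_e) Σ_y w′(y)[(1−p_e)(Σ₁ − F₀₀₀) + p_e(Σ₂ − F₁₁₁)]`
with `Σ₁ = F₁₀₀+F₀₁₀+F₀₀₁`, `Σ₂ = F₀₁₁+F₁₀₁+F₁₁₀` (bits = `e` open in `X,Y,Z`), and the two POINTWISE lemmas `gcert_P0` (`F₀₀₀ ≤ Σ₁`) and
`gcert_P1` (`F₁₁₁ ≤ Σ₂`) hold by a four-case analysis on whether `e` meets `A = cl X a` and/or `B = cl X b`: in three cases one of the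
three single-copy flips of `e` is read by NO output of `Φ₃, Φ₄` (outputs unchanged), and in the case `e ∈ touch A ∩ touch B` flipping `e` in
`Z` only enlarges the output `o₃` of `Φ₃`, in which the potential `λ₃` is monotone (`gq_insert_le`); for `P1` that case forces `a ~_X b`, where
the certificate vanishes.
-/

noncomputable section

namespace Summit.CriticalPhenomena.PercolationContinuityZ3.Theorems

namespace ThreePointGamma

open Finset Literature.Probability.Percolation Literature.Probability.Percolation.DecisionTree
open Literature.Probability.Percolation.Gladkov ThreePointLB
open scoped Classical

variable {V : Type*} [Fintype V] [DecidableEq V]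

/-! ### Splicing and clusters under the insertion of one pair -/

omit [Fintype V] in
/-- Inserting a pair of `F` into the OFF-`F` configuration does not change the splice. [folklore] -/
theorem splice_insert_right_of_mem {F K₁ K₂ : Finset (Sym2 V)} {e : Sym2 V} (he : e ∈ F) :
    splice F K₁ (insert e K₂) = splice F K₁ K₂ := by
  ext i
  by_cases hi : i ∈ F
  · rw [mem_splice_of_mem hi, mem_splice_of_mem hi]
  · rw [mem_splice_of_not_mem hi, mem_splice_of_not_mem hi, Finset.mem_insert]
    exact ⟨fun h => h.resolve_left (fun h' => hi (h' ▸ he)), Or.inr⟩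

omit [Fintype V] in
/-- Inserting a pair NOT in `F` into the ON-`F` configuration does not change the splice. [folklore] -/
theorem splice_insert_left_of_not_mem {F K₁ K₂ : Finset (Sym2 V)} {e : Sym2 V} (he : e ∉ F) :
    splice F (insert e K₁) K₂ = splice F K₁ K₂ :=
  splice_congr_left (fun i hi => by rw [Finset.mem_insert]; exact ⟨fun h => h.resolve_left (fun h' => he (h' ▸ hi)), Or.inr⟩) K₂

omit [Fintype V] in
/-- Inserting a pair NOT in `F` into the off-`F` configuration inserts it into the splice. [folklore] -/
theorem splice_insert_right_of_not_mem {F K₁ K₂ : Finset (Sym2 V)} {e : Sym2 V} (he : e ∉ F) :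
    splice F K₁ (insert e K₂) = insert e (splice F K₁ K₂) := by
  ext i
  rw [Finset.mem_insert]
  by_cases hi : i ∈ F
  · rw [mem_splice_of_mem hi, mem_splice_of_mem hi]
    exact ⟨Or.inr, fun h => h.elim (fun h' => absurd hi (h' ▸ he)) id⟩
  · rw [mem_splice_of_not_mem hi, mem_splice_of_not_mem hi, Finset.mem_insert]

/-- Inserting a pair not meeting the cluster of `x` does not change that cluster. [folklore] -/
theorem cl_insert_of_not_mem_touch {X : Finset (Sym2 V)} {x : V} {e : Sym2 V} (he : e ∉ touch (cl X x)) :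
    cl (insert e X) x = cl X x :=
  cl_eq_of_agree fun f hf => by
    rw [Finset.mem_insert]
    exact ⟨Or.inr, fun h => h.elim (fun h' => absurd hf (h' ▸ he)) id⟩

/-- A pair of the configuration meeting two clusters forces them to coincide. [folklore] -/
theorem mem_cl_of_mem_touch_touch {X : Finset (Sym2 V)} {a b : V} {e : Sym2 V} (heX : e ∈ X)
    (ha : e ∈ touch (cl X a)) (hb : e ∈ touch (cl X b)) : b ∈ cl X a := by
  obtain ⟨v, hv, hve⟩ := mem_touch.1 ha
  obtain ⟨w, hw, hwe⟩ := mem_touch.1 hb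
  -- some vertex lies in both clusters
  have key : ∃ z, z ∈ cl X a ∧ z ∈ cl X b := by
    induction e using Sym2.ind with
    | h u₁ u₂ =>
      by_cases h12 : u₁ = u₂
      · subst h12
        have hv' : v = u₁ := by simpa using hve
        have hw' : w = u₁ := by simpa using hwe
        exact ⟨u₁, hv' ▸ hv, hw' ▸ hw⟩
      · have hadj : (openGraph (↑X : Set (Sym2 V))).Adj u₁ u₂ := adj_iff.2 ⟨heX, h12⟩
        -- both endpoints lie in the cluster of `a`
        have hu : u₁ ∈ cl X a ∧ u₂ ∈ cl X a := by
          rcases Sym2.mem_iff.1 hve with rfl | rfl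
          · exact ⟨hv, mem_cl_of_adj hv hadj⟩
          · exact ⟨mem_cl_of_adj hv hadj.symm, hv⟩
        rcases Sym2.mem_iff.1 hwe with rfl | rfl
        · exact ⟨w, hu.1, hw⟩
        · exact ⟨w, hu.2, hw⟩
  obtain ⟨z, hza, hzb⟩ := key
  exact mem_cl_trans hza (mem_cl_comm.1 hzb)

/-! ### The certificate as a function of the four outputs it reads -/

section GQ

variable (D : Finset (Sym2 V)) (a b c : V)

/-- `Q = a|b|c` as an event. [folklore] -/
def Qe : Set (Finset (Sym2 V)) := (conn a b)ᶜ ∩ ((conn a c)ᶜ ∩ (conn b c)ᶜ)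

/-- The Γ-certificate as a function of the outputs `o₂, o₃` of `Φ₃` and `o₂′, o₃′` of `Φ₄` (the only ones its potentials read). [this work] -/
def gq (o₂ o₃ o₂' o₃' : Finset (Sym2 V)) : ℝ :=
  - pind (o₂ ∈ Qe a b c ∧ o₃ ∈ conn a c)
  - pind (o₂ ∈ Qe a b c ∩ (sepEv D a b c)ᶜ ∧ o₃ ∈ conn b c ∩ (conn a b)ᶜ)
  + pind (o₂' ∈ conn a c ∩ (conn a b)ᶜ ∧ o₃' ∈ conn b c ∩ (conn a b)ᶜ)
  + pind (o₂' ∈ (conn a c)ᶜ ∩ (conn b c)ᶜ ∧ o₃' ∈ conn b c ∩ (conn a b)ᶜ)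
  + pind (o₂' ∈ (conn a c)ᶜ ∩ (conn b c)ᶜ ∧ o₃' ∈ conn a c ∩ (conn a b)ᶜ)
  + pind (o₂' ∈ (conn a b ∩ conn a c) ∩ pivEv a b c ∧ o₃' ∈ conn b c ∩ (conn a b)ᶜ)

/-- `gcert` depends on the triple only through the four read outputs. [this work] -/
theorem gcert_eq_gq (x : Fin 3 → Finset (Sym2 V)) :
    gcert D a b c x = gq D a b c (phi3 a b x 1) (phi3 a b x 2) (phi4 a b x 1) (phi4 a b x 2) := by
  simp only [gcert, gq, Qe, ind_eq_pind, mem_box, Set.mem_univ, true_and]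

variable {D a b c}

/-- `pind` is nonnegative. [folklore] -/
theorem pind_nonneg' (P : Prop) : 0 ≤ pind P := by
  unfold pind; split_ifs <;> norm_num

/-- `pind` is at most one. [folklore] -/
theorem pind_le_one' (P : Prop) : pind P ≤ 1 := by
  unfold pind; split_ifs <;> norm_num

/-- **Monotonicity of `λ₃` in `o₃`**: enlarging the output `o₃` of `Φ₃` by one pair can only lower the certificate. [this work] -/
theorem gq_insert_le (o₂ o₃ o₂' o₃' : Finset (Sym2 V)) (e : Sym2 V) :
    gq D a b c o₂ (insert e o₃) o₂' o₃' ≤ gq D a b c o₂ o₃ o₂' o₃' := by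
  have hsub : o₃ ⊆ insert e o₃ := Finset.subset_insert e o₃
  have hmono : ∀ u v : V, o₃ ∈ conn u v → insert e o₃ ∈ conn u v := fun u v h =>
    mem_conn_iff_mem_cl.2 (cl_mono hsub u (mem_conn_iff_mem_cl.1 h))
  unfold gq
  have h1 := pind_nonneg' (o₂ ∈ Qe a b c ∧ insert e o₃ ∈ conn a c)
  have h2 := pind_nonneg' (o₂ ∈ Qe a b c ∩ (sepEv D a b c)ᶜ ∧ insert e o₃ ∈ conn b c ∩ (conn a b)ᶜ)
  -- compare the two `λ₃` parts
  suffices h : pind (o₂ ∈ Qe a b c ∧ o₃ ∈ conn a c) + pind (o₂ ∈ Qe a b c ∩ (sepEv D a b c)ᶜ ∧ o₃ ∈ conn b c ∩ (conn a b)ᶜ) ≤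
      pind (o₂ ∈ Qe a b c ∧ insert e o₃ ∈ conn a c) + pind (o₂ ∈ Qe a b c ∩ (sepEv D a b c)ᶜ ∧ insert e o₃ ∈ conn b c ∩ (conn a b)ᶜ) by
    linarith
  by_cases hac : o₃ ∈ conn a c
  · -- then `insert e o₃ ∈ conn a c`, and `o₃ ∉ Pa`
    have hPa : ¬ (o₃ ∈ conn b c ∩ (conn a b)ᶜ) := fun h => h.2 (mem_conn_iff_mem_cl.2
      (mem_cl_trans (mem_conn_iff_mem_cl.1 hac) (mem_cl_comm.1 (mem_conn_iff_mem_cl.1 h.1))))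
    have e2 : pind (o₂ ∈ Qe a b c ∩ (sepEv D a b c)ᶜ ∧ o₃ ∈ conn b c ∩ (conn a b)ᶜ) = 0 := by
      unfold pind; rw [if_neg (fun h => hPa h.2)]
    have e1 : pind (o₂ ∈ Qe a b c ∧ o₃ ∈ conn a c) = pind (o₂ ∈ Qe a b c ∧ insert e o₃ ∈ conn a c) := by
      unfold pind
      by_cases hq : o₂ ∈ Qe a b c
      · rw [if_pos ⟨hq, hac⟩, if_pos ⟨hq, hmono a c hac⟩]
      · rw [if_neg (fun h => hq h.1), if_neg (fun h => hq h.1)]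
    linarith
  · have e1 : pind (o₂ ∈ Qe a b c ∧ o₃ ∈ conn a c) = 0 := by unfold pind; rw [if_neg (fun h => hac h.2)]
    by_cases hPa : o₃ ∈ conn b c ∩ (conn a b)ᶜ
    · by_cases hq : o₂ ∈ Qe a b c ∩ (sepEv D a b c)ᶜ
      · have e2 : pind (o₂ ∈ Qe a b c ∩ (sepEv D a b c)ᶜ ∧ o₃ ∈ conn b c ∩ (conn a b)ᶜ) = 1 := by
          unfold pind; rw [if_pos ⟨hq, hPa⟩]
        -- after the insertion: either still `Pa`, or `a` has joined the `bc`-cluster, whence `a ~ c`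
        by_cases hab : insert e o₃ ∈ conn a b
        · have hac' : insert e o₃ ∈ conn a c := mem_conn_iff_mem_cl.2
            (mem_cl_trans (mem_conn_iff_mem_cl.1 hab) (mem_conn_iff_mem_cl.1 (hmono b c hPa.1)))
          have e3 : pind (o₂ ∈ Qe a b c ∧ insert e o₃ ∈ conn a c) = 1 := by unfold pind; rw [if_pos ⟨hq.1, hac'⟩]
          linarith
        · have e3 : pind (o₂ ∈ Qe a b c ∩ (sepEv D a b c)ᶜ ∧ insert e o₃ ∈ conn b c ∩ (conn a b)ᶜ) = 1 := by
            unfold pind; rw [if_pos ⟨hq, ⟨hmono b c hPa.1, hab⟩⟩]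
          linarith
      · have e2 : pind (o₂ ∈ Qe a b c ∩ (sepEv D a b c)ᶜ ∧ o₃ ∈ conn b c ∩ (conn a b)ᶜ) = 0 := by
          unfold pind; rw [if_neg (fun h => hq h.1)]
        linarith
    · have e2 : pind (o₂ ∈ Qe a b c ∩ (sepEv D a b c)ᶜ ∧ o₃ ∈ conn b c ∩ (conn a b)ᶜ) = 0 := by
        unfold pind; rw [if_neg (fun h => hPa h.2)]
      linarith

/-- If `a ~ b` in `o₂` and in `o₃′`, the certificate is `≥ 0` (both `λ₃` terms vanish). [this work] -/
theorem gq_nonneg_of_conn {o₂ o₃ o₂' o₃' : Finset (Sym2 V)} (h₂ : o₂ ∈ conn a b) :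
    0 ≤ gq D a b c o₂ o₃ o₂' o₃' := by
  unfold gq
  have e1 : pind (o₂ ∈ Qe a b c ∧ o₃ ∈ conn a c) = 0 := by unfold pind; rw [if_neg (fun h => h.1.1 h₂)]
  have e2 : pind (o₂ ∈ Qe a b c ∩ (sepEv D a b c)ᶜ ∧ o₃ ∈ conn b c ∩ (conn a b)ᶜ) = 0 := by
    unfold pind; rw [if_neg (fun h => h.1.1.1 h₂)]
  have h3 := pind_nonneg' (o₂' ∈ conn a c ∩ (conn a b)ᶜ ∧ o₃' ∈ conn b c ∩ (conn a b)ᶜ)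
  have h4 := pind_nonneg' (o₂' ∈ (conn a c)ᶜ ∩ (conn b c)ᶜ ∧ o₃' ∈ conn b c ∩ (conn a b)ᶜ)
  have h5 := pind_nonneg' (o₂' ∈ (conn a c)ᶜ ∩ (conn b c)ᶜ ∧ o₃' ∈ conn a c ∩ (conn a b)ᶜ)
  have h6 := pind_nonneg' (o₂' ∈ (conn a b ∩ conn a c) ∩ pivEv a b c ∧ o₃' ∈ conn b c ∩ (conn a b)ᶜ)
  linarith

end GQ

/-! ### Outputs of the two switchings on explicit triples -/

section Outputs

variable (a b : V) (X Y Z : Finset (Sym2 V))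

/-- Output `1` of `Φ₃` on an explicit triple. [folklore] -/
theorem phi3_one_vec : phi3 a b ![X, Y, Z] 1 = splice (touch (cl X a)) X Y := by simp [phi3_one]
/-- Output `2` of `Φ₃` on an explicit triple. [folklore] -/
theorem phi3_two_vec : phi3 a b ![X, Y, Z] 2 = splice (touch (cl X b) \ touch (cl X a)) X Z := by simp [phi3_two]
/-- Output `1` of `Φ₄` on an explicit triple. [folklore] -/
theorem phi4_one_vec : phi4 a b ![X, Y, Z] 1 = splice (touch (cl X a) \ touch (cl X b)) X Y := by simp [phi4_one]
/-- Output `2` of `Φ₄` on an explicit triple. [folklore] -/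
theorem phi4_two_vec : phi4 a b ![X, Y, Z] 2 = splice (touch (cl X b)) X Z := by simp [phi4_two]

end Outputs

/-- Removing a pair not meeting the enlarged cluster does not change it. [folklore] -/
theorem cl_eq_cl_insert_of_not_mem_touch {X : Finset (Sym2 V)} {x : V} {e : Sym2 V} (he : e ∉ touch (cl (insert e X) x)) :
    cl X x = cl (insert e X) x :=
  cl_eq_of_agree fun f hf => by
    rw [Finset.mem_insert]
    exact ⟨fun h => h.elim (fun h' => absurd hf (h' ▸ he)) id, Or.inr⟩

/-! ### The functional `Γ` of a weighted law and its three-copy representation -/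

section Functional

variable (D : Finset (Sym2 V)) (p : Sym2 V → ℝ) (a b c : V)

/-- `Γ(D,p) = q t − u_a u_b − u_a u_c − u_b u_c − u_a (n_a + n′_a)` of the weighted law on the support `D` (cells as `PrW`'s, exactly as in
`gamma_PrW`). [this work] -/
def GamP : ℝ :=
  PrW D p ((conn a b)ᶜ ∩ ((conn a c)ᶜ ∩ (conn b c)ᶜ)) * PrW D p (conn a b ∩ conn a c)
    - PrW D p (conn b c ∩ (conn a b)ᶜ) * PrW D p (conn a c ∩ (conn a b)ᶜ)
    - PrW D p (conn b c ∩ (conn a b)ᶜ) * PrW D p (conn a b ∩ (conn a c)ᶜ)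
    - PrW D p (conn a c ∩ (conn a b)ᶜ) * PrW D p (conn a b ∩ (conn a c)ᶜ)
    - PrW D p (conn b c ∩ (conn a b)ᶜ) *
        (PrW D p ((conn a b ∩ conn a c) ∩ pivEv a b c) + PrW D p (((conn a b)ᶜ ∩ ((conn a c)ᶜ ∩ (conn b c)ᶜ)) ∩ sepEv D a b c))

/-- **Three-copy representation**: `Γ(D,p) = Σ_x wt3W(x) · (−S(x))` (PROOF-GAMMA identity (E), measure preservation of `Φ₃, Φ₄`). [this work] -/
theorem GamP_eq_sum : GamP D p a b c = ∑ x ∈ triples D, wt3W D p x * (- gcert D a b c x) := by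
  have t2 : ∀ K : Finset (Sym2 V), K ∈ conn a b → K ∈ conn b c → K ∈ conn a c :=
    fun K hab hbc => mem_conn.2 ((mem_conn.1 hab).trans (mem_conn.1 hbc))
  have R1 : PrW D p (conn a c) = PrW D p (conn a c ∩ (conn a b)ᶜ) + PrW D p (conn a b ∩ conn a c) := by
    rw [← PrW_union D p]
    · refine PrW_congr_set D p fun K _ => ?_
      simp only [Set.mem_union, Set.mem_inter_iff, Set.mem_compl_iff]
      tauto
    · exact Set.disjoint_left.2 fun K h1 h2 => h1.2 h2.1
  have R4 : PrW D p ((conn a c)ᶜ ∩ (conn b c)ᶜ) = PrW D p ((conn a b)ᶜ ∩ ((conn a c)ᶜ ∩ (conn b c)ᶜ)) +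
      PrW D p (conn a b ∩ (conn a c)ᶜ) := by
    rw [← PrW_union D p]
    · refine PrW_congr_set D p fun K _ => ?_
      simp only [Set.mem_union, Set.mem_inter_iff, Set.mem_compl_iff]
      have := t2 K; tauto
    · exact Set.disjoint_left.2 fun K h1 h2 => h1.1 h2.1
  have Rs : PrW D p (((conn a b)ᶜ ∩ ((conn a c)ᶜ ∩ (conn b c)ᶜ)) ∩ (sepEv D a b c)ᶜ) =
      PrW D p ((conn a b)ᶜ ∩ ((conn a c)ᶜ ∩ (conn b c)ᶜ)) - PrW D p (((conn a b)ᶜ ∩ ((conn a c)ᶜ ∩ (conn b c)ᶜ)) ∩ sepEv D a b c) := by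
    have h : PrW D p ((conn a b)ᶜ ∩ ((conn a c)ᶜ ∩ (conn b c)ᶜ)) =
        PrW D p (((conn a b)ᶜ ∩ ((conn a c)ᶜ ∩ (conn b c)ᶜ)) ∩ sepEv D a b c) +
          PrW D p (((conn a b)ᶜ ∩ ((conn a c)ᶜ ∩ (conn b c)ᶜ)) ∩ (sepEv D a b c)ᶜ) := by
      rw [← PrW_union D p]
      · refine PrW_congr_set D p fun K _ => ?_
        simp only [Set.mem_union, Set.mem_inter_iff, Set.mem_compl_iff]
        tauto
      · exact Set.disjoint_left.2 fun K h1 h2 => h2.2 h1.2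
    linarith
  have hU : PrW D p (Set.univ : Set (Finset (Sym2 V))) = 1 := PrW_univ D p
  have hsum := sum_wt3W_gcert p D a b c
  rw [R1, R4, Rs, hU] at hsum
  have hid := gamma_identity (PrW D p ((conn a b)ᶜ ∩ ((conn a c)ᶜ ∩ (conn b c)ᶜ))) (PrW D p (conn b c ∩ (conn a b)ᶜ))
    (PrW D p (conn a c ∩ (conn a b)ᶜ)) (PrW D p (conn a b ∩ (conn a c)ᶜ)) (PrW D p (conn a b ∩ conn a c))
    (PrW D p ((conn a b ∩ conn a c) ∩ pivEv a b c)) (PrW D p (((conn a b)ᶜ ∩ ((conn a c)ᶜ ∩ (conn b c)ᶜ)) ∩ sepEv D a b c))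
  have hneg : ∑ x ∈ triples D, wt3W D p x * (- gcert D a b c x) = - ∑ x ∈ triples D, wt3W D p x * gcert D a b c x := by
    rw [← Finset.sum_neg_distrib]
    exact Finset.sum_congr rfl fun x _ => by ring
  rw [hneg, hsum, GamP]
  linarith

/-- `Γ ≥ 0` restated for `GamP` (`gamma_PrW`). [this work] -/
theorem gamP_nonneg {p : Sym2 V → ℝ} (hp0 : ∀ i, 0 ≤ p i) (hp1 : ∀ i, p i ≤ 1) : 0 ≤ GamP D p a b c :=
  gamma_PrW hp0 hp1 D a b c

end Functional

/-! ### Splitting a three-copy sum along one coordinate into its eight Bernstein pieces -/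

section Split8

/-- The bits of three copies as a triple of Booleans. [folklore] -/
def bits3 : Bool × Bool × Bool ≃ (Fin 3 → Bool) where
  toFun q := ![q.1, q.2.1, q.2.2]
  invFun β := (β 0, β 1, β 2)
  left_inv q := by
    rcases q with ⟨q0, q1, q2⟩
    simp
  right_inv β := by
    funext i
    fin_cases i <;> simp

/-- A sum over `Fin 3 → Bool` as eight terms. [folklore] -/
theorem sum_bits3 (g : (Fin 3 → Bool) → ℝ) :
    ∑ β, g β = g ![false, false, false] + g ![false, false, true] + g ![false, true, false] + g ![false, true, true]
      + g ![true, false, false] + g ![true, false, true] + g ![true, true, false] + g ![true, true, true] := by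
  rw [← Equiv.sum_comp bits3]
  simp only [Fintype.sum_prod_type, Fintype.sum_bool, bits3, Equiv.coe_fn_mk]
  ring

omit [Fintype V] in
/-- `ins` along an explicit bit vector. [folklore] -/
theorem ins_vec (e : Sym2 V) (b0 b1 b2 : Bool) (y : Fin 3 → Finset (Sym2 V)) :
    (fun i => DTree2.ins e (![b0, b1, b2] i) (y i)) = ![DTree2.ins e b0 (y 0), DTree2.ins e b1 (y 1), DTree2.ins e b2 (y 2)] := by
  funext i
  fin_cases i <;> simp

omit [Fintype V] in
/-- `ins e true = insert e`. [folklore] -/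
@[simp] theorem ins_true (e : Sym2 V) (R : Finset (Sym2 V)) : DTree2.ins e true R = insert e R := by simp [DTree2.ins]

omit [Fintype V] in
/-- `ins e false = id`. [folklore] -/
@[simp] theorem ins_false (e : Sym2 V) (R : Finset (Sym2 V)) : DTree2.ins e false R = R := by simp [DTree2.ins]

/-- The eight Bernstein pieces of a function of triples along the coordinate `e`, with parameter `s = p_e`. [this work] -/
def bern8 (s : ℝ) (F : (Fin 3 → Finset (Sym2 V)) → ℝ) (e : Sym2 V) (y : Fin 3 → Finset (Sym2 V)) : ℝ :=
  (1 - s) ^ 3 * F ![y 0, y 1, y 2]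
  + (1 - s) ^ 2 * s * (F ![insert e (y 0), y 1, y 2] + F ![y 0, insert e (y 1), y 2] + F ![y 0, y 1, insert e (y 2)])
  + (1 - s) * s ^ 2 * (F ![y 0, insert e (y 1), insert e (y 2)] + F ![insert e (y 0), y 1, insert e (y 2)]
      + F ![insert e (y 0), insert e (y 1), y 2])
  + s ^ 3 * F ![insert e (y 0), insert e (y 1), insert e (y 2)]

omit [Fintype V] in
/-- **Eight-piece split** of a weighted three-copy sum along `e ∈ D` (from `DTree3.sum_triples_split`). [this work] -/
theorem sum_triples_split8 (D : Finset (Sym2 V)) (p : Sym2 V → ℝ) {e : Sym2 V} (he : e ∈ D) (F : (Fin 3 → Finset (Sym2 V)) → ℝ) :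
    ∑ x ∈ triples D, wt3W D p x * F x = ∑ y ∈ triples (D.erase e), wt3W (D.erase e) p y * bern8 (p e) F e y := by
  rw [DTree3.sum_triples_split D p he F, sum_bits3]
  simp only [ins_vec, ins_true, ins_false, Fin.prod_univ_three, Matrix.cons_val_zero, Matrix.cons_val_one, Matrix.head_cons,
    Matrix.cons_val_two, Matrix.tail_cons, DTree2.wt1, if_true, Bool.false_eq_true, if_false, Finset.mul_sum, ← Finset.sum_add_distrib]
  refine Finset.sum_congr rfl fun y _ => ?_
  simp only [bern8]
  ring

omit [Fintype V] in
/-- Off the coordinate `e`, the weights do not see an update of `p` at `e`. [folklore] -/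
theorem wt3W_erase_update (D : Finset (Sym2 V)) (p : Sym2 V → ℝ) (e : Sym2 V) (v : ℝ) (y : Fin 3 → Finset (Sym2 V)) :
    wt3W (D.erase e) (Function.update p e v) y = wt3W (D.erase e) p y := by
  unfold wt3W wtW
  refine Finset.prod_congr rfl fun i _ => Finset.prod_congr rfl fun f hf => ?_
  rw [Function.update_of_ne (Finset.ne_of_mem_erase hf)]

end Split8


end ThreePointGamma

end Summit.CriticalPhenomena.PercolationContinuityZ3.Theorems

end
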